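import Summits.ResolutionOfSingularities.ResolutionOfSingularities.Theorems.FrobeniusClosingPatchingRelPerfectDepthParamLiftFlat
import Literature.AlgebraicGeometry.Resolution.BlowupChartSNCLocal
import Literature.AlgebraicGeometry.Resolution.BlowupAlgebraQuasiRegularChart
import Literature.AlgebraicGeometry.Resolution.NodalBlowupChartAlgebra
import HarnessLib

/-!
# Crux `PatchingRelPerfect` (stmt-ResolutionOfSingularities-16161), chain W5.2 — F7(β) d = 2 (β-AX), X2a module 2 (M2c), e-chart step E2b (i):
# the stalk of a blowing up MODULO THE EXCEPTIONAL PARAMETER is a localisation of a polynomial ring over `A/𝔞`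

[OURS · L1 W5.2 · F7(β) (β-AX) X-side · res-D-pv-034 AS res-L1-s36-pv-3 per res-L1-w52-plan-1 RULING G11-21 ((M2c) PARAM
PROPAGATION, e-chart half; blueprint `D/res-D-pv-034/M2C-ECHART-BLUEPRINT.md` step E2).]  Replaces the role of NO printed item;
NOT a statement of the manuscript under review; fact-free, def-free.  AI-written; AI review is weaker than expert review.

Ring-level: `A` local, `a : Fin c → A` part of a regular system of parameters, `l : Fin c`, `S` a localisation of the affine blowup
algebra `A[𝔞/a_l]` (`blowupAlgebra`) at a prime `𝔔` over `𝔪_A` through `χ` (the shape delivered by the stalk presentation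
`exists_blowupAlgebra_stalk_ringEquiv_of_stalkIdeal_eq_span(_at)`).  Then `S ⧸ (a_l)` is the localisation of the polynomial ring
`P = (A/𝔞)[T_m : m ≠ l]` at a prime `𝔓` over the maximal ideal of `A/𝔞`, for the algebra structure
`P ≅ A[𝔞/a_l]/(a_l) → S/(a_l)` (`blowupAlgebraQuotEquiv`, tree `BlowupAlgebraQuasiRegularChart`; `isLocalization_atPrime_quotient_of_ringEquiv`,
tree `BlowupChartSNCLocal`).

* **`exists_isLocalization_quotient_blowupAlgebra`**.

## References
* The Stacks Project, Tag 0BIQ (affine blowup algebra of a regular sequence modulo the exceptional divisor). [StacksProject]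
* U. Görtz, T. Wedhorn, *Algebraic Geometry I* (2020), (13.19). [GortzWedhorn2020]
-/

-- `Summit.<Summit>.<Sub>.Theorems` with `Sub = Summit` (single-conjunct summit, D-0017)
set_option linter.dupNamespace false

noncomputable section

open IsLocalRing
open Literature.AlgebraicGeometry.Resolution

namespace Summit.ResolutionOfSingularities.ResolutionOfSingularities.Theorems.DepthMultiHost

universe u

set_option maxHeartbeats 400000 in -- the chart algebra `blowupAlgebra` is a subalgebra of a localisation: slow instance unification (cf. p537631)
/-- [OURS · L1 W5.2 · F7(β) (β-AX) M2c, E2b (i)] **The stalk modulo the exceptional parameter is a localised polynomial ring over `A/𝔞`.**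
For `S = A[𝔞/a_l]_𝔔` (`𝔔` over `𝔪_A`, presentation map `χ`): with `J = (a_l) ⊆ A[𝔞/a_l]`, `P = (A/𝔞)[T_m : m ≠ l]` and
`ε = blowupAlgebraQuotEquiv : P ≅ A[𝔞/a_l]/J`, there is a prime `𝔓 ⊂ P` over the maximal ideal of the local ring `A/𝔞` such that
`S/J S` is the localisation of `P` at `𝔓` for the structure map `P ≅ A[𝔞/a_l]/J → S/JS`, and `ε (𝔓) ↔ 𝔔`.
[cite: StacksProject, Tag 0BIQ] -/
theorem exists_isLocalization_quotient_blowupAlgebra {A : Type u} [CommRing A] [IsLocalRing A] {c : ℕ} (a : Fin c → A)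
    (ha : IsRsopPart a) (l : Fin c) {S : Type u} [CommRing S]
    (χ : blowupAlgebra (Ideal.span (Set.range a)) (a l) →+* S)
    (𝔔 : PrimeSpectrum (blowupAlgebra (Ideal.span (Set.range a)) (a l)))
    (hloc : @IsLocalization.AtPrime _ _ S _ χ.toAlgebra 𝔔.asIdeal _)
    (h𝔔 : 𝔔.asIdeal.comap (algebraMap A (blowupAlgebra (Ideal.span (Set.range a)) (a l))) = maximalIdeal A)
    [IsLocalRing (A ⧸ Ideal.span (Set.range a))] :
    ∃ (𝔓 : Ideal (MvPolynomial {m : Fin c // m ≠ l} (A ⧸ Ideal.span (Set.range a)))) (_ : 𝔓.IsPrime)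
      (algP : MvPolynomial {m : Fin c // m ≠ l} (A ⧸ Ideal.span (Set.range a)) →+*
        S ⧸ (Ideal.span {algebraMap A (blowupAlgebra (Ideal.span (Set.range a)) (a l)) (a l)}).map χ),
      (∀ b, (blowupAlgebraQuotEquiv a l ha.isQuasiRegular).symm (Ideal.Quotient.mk _ b) ∈ 𝔓 ↔ b ∈ 𝔔.asIdeal) ∧
      𝔓.comap (MvPolynomial.C) = maximalIdeal (A ⧸ Ideal.span (Set.range a)) ∧
      (∀ r, algP (MvPolynomial.C (Ideal.Quotient.mk _ r)) =
        Ideal.Quotient.mk _ (χ (algebraMap A (blowupAlgebra (Ideal.span (Set.range a)) (a l)) r))) ∧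
      (∀ m : {m : Fin c // m ≠ l}, algP (MvPolynomial.X m) =
        Ideal.Quotient.mk _ (χ (blowupAlgebra.gen (Ideal.span (Set.range a)) (a l) (a m.1)
          (Ideal.mem_span_range_self (f := a) (x := m.1))))) ∧
      @IsLocalization.AtPrime _ _
        (S ⧸ (Ideal.span {algebraMap A (blowupAlgebra (Ideal.span (Set.range a)) (a l)) (a l)}).map χ) _
        algP.toAlgebra 𝔓 _ := by
  classical
  letI := χ.toAlgebra
  haveI := hloc
  haveI := ha.isRegularLocalRing
  let J : Ideal (blowupAlgebra (Ideal.span (Set.range a)) (a l)) :=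
    Ideal.span {algebraMap A (blowupAlgebra (Ideal.span (Set.range a)) (a l)) (a l)}
  let ε := blowupAlgebraQuotEquiv a l ha.isQuasiRegular
  -- `J ⊆ 𝔔`
  have hJQ : J ≤ 𝔔.asIdeal := by
    show Ideal.span _ ≤ _
    rw [Ideal.span_singleton_le_iff_mem, ← Ideal.mem_comap, h𝔔]
    exact ha.mem_maximalIdeal l
  -- the prime `𝔓`
  haveI hQmap : (𝔔.asIdeal.map (Ideal.Quotient.mk J)).IsPrime :=
    Ideal.map_isPrime_of_surjective Ideal.Quotient.mk_surjective (by rwa [Ideal.mk_ker])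
  let 𝔓 : Ideal (MvPolynomial {m : Fin c // m ≠ l} (A ⧸ Ideal.span (Set.range a))) :=
    (𝔔.asIdeal.map (Ideal.Quotient.mk J)).comap ε.toRingHom
  haveI h𝔓 : 𝔓.IsPrime := Ideal.comap_isPrime _ _
  have hmem : ∀ b, ε.symm (Ideal.Quotient.mk J b) ∈ 𝔓 ↔ b ∈ 𝔔.asIdeal := fun b => by
    show ε.toRingHom (ε.symm (Ideal.Quotient.mk J b)) ∈ 𝔔.asIdeal.map (Ideal.Quotient.mk J) ↔ _
    rw [RingEquiv.toRingHom_eq_coe, RingEquiv.coe_toRingHom, ε.apply_symm_apply, Ideal.mem_quotient_iff_mem hJQ]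
  let algP : MvPolynomial {m : Fin c // m ≠ l} (A ⧸ Ideal.span (Set.range a)) →+* S ⧸ J.map χ :=
    (Ideal.quotientMap (J.map χ) χ Ideal.le_comap_map).comp ε.toRingHom
  have halgC : ∀ r, algP (MvPolynomial.C (Ideal.Quotient.mk _ r)) =
      Ideal.Quotient.mk _ (χ (algebraMap A (blowupAlgebra (Ideal.span (Set.range a)) (a l)) r)) := fun r => by
    show Ideal.quotientMap (J.map χ) χ Ideal.le_comap_map (ε (MvPolynomial.C (Ideal.Quotient.mk _ r))) = _
    rw [blowupAlgebraQuotEquiv_C, Ideal.quotientMap_mk]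
  have halgX : ∀ m : {m : Fin c // m ≠ l}, algP (MvPolynomial.X m) =
      Ideal.Quotient.mk _ (χ (blowupAlgebra.gen (Ideal.span (Set.range a)) (a l) (a m.1)
        (Ideal.mem_span_range_self (f := a) (x := m.1)))) := fun m => by
    show Ideal.quotientMap (J.map χ) χ Ideal.le_comap_map (ε (MvPolynomial.X m)) = _
    rw [blowupAlgebraQuotEquiv_X, Ideal.quotientMap_mk]
  refine ⟨𝔓, h𝔓, algP, hmem, ?_, halgC, halgX, ?_⟩
  · -- `𝔓 ∩ (A/𝔞) = 𝔪`
    refine ((IsLocalRing.maximalIdeal.isMaximal _).eq_of_le (Ideal.IsPrime.ne_top inferInstance) ?_).symm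
    intro x hx
    obtain ⟨r, rfl⟩ := Ideal.Quotient.mk_surjective x
    have hr : r ∈ maximalIdeal A := by
      haveI := IsLocalHom.of_surjective (Ideal.Quotient.mk (Ideal.span (Set.range a))) Ideal.Quotient.mk_surjective
      exact ((map_mem_nonunits_iff (Ideal.Quotient.mk (Ideal.span (Set.range a))) r).mp hx)
    rw [Ideal.mem_comap]
    show ε.toRingHom (MvPolynomial.C (Ideal.Quotient.mk _ r)) ∈ 𝔔.asIdeal.map (Ideal.Quotient.mk J)
    rw [RingEquiv.toRingHom_eq_coe, RingEquiv.coe_toRingHom, blowupAlgebraQuotEquiv_C, Ideal.mem_quotient_iff_mem hJQ,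
      ← Ideal.mem_comap, h𝔔]
    exact hr
  · exact isLocalization_atPrime_quotient_of_ringEquiv 𝔔.asIdeal J ε 𝔓 hmem

end Summit.ResolutionOfSingularities.ResolutionOfSingularities.Theorems.DepthMultiHost

end
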